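import Summits.CriticalPhenomena.PercolationContinuityZ3.Theorems.PercNearOneGluingNoHeavyConstsCrossMarkerZTwoNeighbours
import Summits.CriticalPhenomena.PercolationContinuityZ3.Theorems.PercNearOneGluingNoHeavyConstsCrossMarkerZLayerCake
import HarnessLib

/-!
# The u = z CROSS member in the two-neighbour class for EVERY monotone functional (all values)
# (PAPER-2 track (ii): constants of the CSH family; seat `prim-consts-2`, gen 26)

builds on p205010 (kernel theorem, internal audit signed; external expert review pending).  Support file (`--supports
stmt-CriticalPhenomena-4575`); memo `run/shared/lean/prim/consts/FROM-prim-consts-2-g26-SEPARABLE-MARKER.md`.  One theorem; no definitions, no sorries,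
standard axioms: `Consts.TwoNeighbours.crossM2_twoNeighbours` (0/1-valued monotone functionals) upgraded to arbitrary monotone functionals by the layer
cake `Consts.crossM2_nonneg_of_levelSets`.
[cite: VandenbergHaggstromKahn2005, Thm. 1.1 (pp. 3–5), §2.1 (pp. 9–13)]
-/

noncomputable section

namespace Summit.CriticalPhenomena.PercolationContinuityZ3.Theorems

open MeasureTheory Set Literature.Probability.LatticeModels Literature.Probability.Percolation
open scoped Classical

namespace Consts

namespace TwoNeighbours

variable {n : ℕ}

/-- **THE u = z CROSS MEMBER FOR EVERY MONOTONE FUNCTIONAL (all values) IN THE TWO-NEIGHBOUR CLASS `N(z) ⊆ {s, y}`.**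
[cite: VandenbergHaggstromKahn2005, Thm. 1.1 (pp. 3–5), §2.1 (pp. 9–13)] -/
theorem crossM2_twoNeighbours_all (w : Sym2 (Fin n) → unitInterval) {s y z : Fin n} (hsy : s ≠ y) (hsz : s ≠ z) (hyz : y ≠ z)
    (hz : ∀ t, t ≠ s → t ≠ y → t ≠ z → w s(z, t) = 0) (F : Set (Sym2 (Fin n)) → ℝ) (hF : Monotone F) :
    0 ≤ polMargin (prodBernoulli w) s y z F (insert z ∅) (insert z ∅) ∅ +
          polMargin (prodBernoulli w) s y z F (insert z ∅) ∅ (insert z ∅) +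
        polMargin (prodBernoulli w) s y z F ∅ (insert z ∅) (insert z ∅) :=
  crossM2_nonneg_of_levelSets w s y z z ∅ (fun G hGm hG01 => crossM2_twoNeighbours w hsy hsz hyz hz G hGm hG01) F hF

end TwoNeighbours

end Consts

end Summit.CriticalPhenomena.PercolationContinuityZ3.Theorems

end
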